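import Summits.QuantumFields.YangMills.Theorems.BalabanLadderROTTiltBoundaryDecayNamed
import Literature.MathematicalPhysics.QuantumLattice.GaugeGroupsProofs
import Mathlib.Analysis.CStarAlgebra.Matrix
import HarnessLib

/-!
# Crux `ROT` (stmt-QuantumFields-20042): the infrared input `BoundaryDecayAllPos` is UNSATISFIABLE as typed — second erratum, and the guarded form

Helper file of the fleet lead `ym-spine-20042-p1` (generation g5), `--supports stmt-QuantumFields-20042` (count-neutral).

SECOND ERRATUM to the boundary-decay input (after g4's `b = 0` erratum, `Theorems/BalabanLadderROTTiltBoundaryDecayPos.lean`).  The repaired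
texts of `Theorems/BalabanLadderROTClassDefs.lean` §6 (p486516) are

* `BoundaryDecayInUnitsPos G r a` — boundary-influence decay of the cube kernels at rate `c₆ · a(β)` per lattice unit of depth on NON-DEGENERATE
  cubes `b ≥ 1`, for `β ≥ β₆`;
* `BoundaryDecayAllPos := ∀ G (compact simple) ∀ r ∀ a : ℝ → ℝ, BoundaryDecayInUnitsPos G r a` — for EVERY function `a`, with NO guard
  (not even `a → 0`).

The unit cube `b = 1` still has NO interior link (`cubeEdges c 1 = ∅`: a link needs both endpoints in the cube), yet its only site has depth `1`
(`depth c 1 c = 1`); so at `(b, d) = (1, 1)` the kernel is evaluation at the exterior while the bound carries the factor `exp (−c₆ · a(β))`.  Reading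
one exterior link through a bounded continuous `f : G → ℝ` gives, for `β ≥ β₆` and all `g₁ g₂ : G`,
`|f g₁ − f g₂| ≤ K₆ · M · exp (−c₆ · a(β))` (`abs_sub_le_of_boundaryDecayInUnitsPos`).  Consequently

* `exists_forall_le_of_boundaryDecayInUnitsPos`: for a non-trivial gauge group, `BoundaryDecayInUnitsPos G r a` forces the unit map `a` to be
  BOUNDED ABOVE on a tail `[β₆, ∞)` — harmless for the intended unit maps `a → 0` (g4's «trivial regime»), fatal for an arbitrary `a`;
* `not_boundaryDecayAllPos : ¬ BoundaryDecayAllPos` — instance `G = SU(2)`, any `r`, `a = id`.  Hence `ti_of_boundaryDecayAllPos`,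
  `kingOnClass_of_nrot3_of_boundaryDecayAllPos`, `rotRev2'_of_nrot3_of_boundaryDecayAllPos` (p486809) and the inline-hypothesis closers
  `ti_of_boundaryDecayPos`, `rotRev2'_of_nrot3_of_boundaryDecayPos` (p486406, same `∀ a` hypothesis) are VACUOUS (true, unsatisfiable hypothesis),
  exactly as the §5 chain was.  The per-`(G, r, a)` statements `tiltInsensitivityOn_of_boundaryDecayInUnitsPos`,
  `tiltedRegComparisonOn_iff_latticeKingWardOn_of_boundaryDecayInUnitsPos` are NOT affected (for a genuine unit map `a → 0` their hypothesis is the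
  honest infrared input).

THE GUARDED FORM (§5).  The tilt half consumes the boundary-decay input only at the `(G, r, a)` at which `TI` is asked, i.e. behind the guard block of
`TI` / `NROT3` / `KingOnClass` (`∀ β, 0 < a β`, `a → 0`, `MomentBounds6 G r a`, `GapInUnits G r a`).  With the input typed behind that SAME guard block
(inline hypothesis `hBD` below; to be NAMED `BoundaryDecayGuarded` in ClassDefs §7, owner's / reviewers' call) the closers go through verbatim:
`ti_of_boundaryDecayGuarded`, `kingOnClass_of_nrot3_of_boundaryDecayGuarded`, `rotRev2'_of_nrot3_of_boundaryDecayGuarded :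
NROT3(S₅) → ‹guarded BD› → ROTRev2'`.  The guarded input is no longer refutable at `b = 1` (`a → 0` is bounded on a tail, `K₆ ≥ 2 e^{c₆ sup a}`
absorbs the corner); its content for deep supports `d ≥ 2` on large cubes is exponential weak mixing of lattice Yang–Mills in PHYSICAL units at
weak coupling — mass-gap strength, open, in print only at strong coupling (Osterwalder–Seiler 1978) — the same strength as `GapInUnits`.

TYPED CENSUS of the crux after g5: `ROTRev2' ⇐ NROT3 king345.tiltCell (arcsin 3/5) (fittedClass 5) ∧ ‹guarded BD›` (this file), or
`⇐ NROT3(S₅) ∧ TI(S₅)` (p469977 / `rotRev2'_of_tilt345`); `BoundaryDecayAllPos` must NOT be registered as a stub text.  0 definitions, 0 sorry.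

Refs: Georgii, *Gibbs Measures and Phase Transitions* (2011) §8.2 (weak mixing — the notion); K. Osterwalder, E. Seiler, Ann. Phys. **110** (1978)
(strong coupling); C. King, Commun. Math. Phys. **103** (1986) 323 (the tilt mechanism).
-/

set_option autoImplicit false

noncomputable section

open MeasureTheory Filter Topology
open Literature.MathematicalPhysics.QuantumFieldTheory Literature.MathematicalPhysics.QuantumLattice
open Summit.QuantumFields.YangMills.Cruxes.OSLegsFromFemtoAndGap.DlrCollarTransfer
open Summit.QuantumFields.YangMills.Cruxes.OSLegsFromFemtoAndGap.DlrCollarTransfer.StubLower (mem_cubeSites_iff)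
open Summit.QuantumFields.YangMills.Cruxes.OSLegsAtWeakCouplingC.Y2Bridge

namespace Summit.QuantumFields.YangMills.Theorems.ROT

open PythTriple

/-! ## §1 The unit cube `b = 1`: no interior link, depth one -/

section UnitCube

variable {G : Type} [Group G] [TopologicalSpace G] [IsTopologicalGroup G] [CompactSpace G]
  [MeasurableSpace G] [BorelSpace G]

/-- The unit cube `(c, 1)` (one site) has no interior link: a link based at `c` ends at `c + eⱼ ∉ {c}`. [folklore] -/
theorem not_mem_cubeEdges_one (c : Fin 4 → ℤ) (e : Literature.MathematicalPhysics.QuantumLattice.ZdEdge 4) :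
    e ∉ cubeEdges c 1 := fun he => by
  have h₁ := ((mem_cubeSites_iff c 1 e.1).1 (fst_mem_cubeSites_of_mem_cubeEdges he)) e.2
  have h₂ := ((mem_cubeSites_iff c 1 _).1 (Finset.mem_filter.1 he).2) e.2
  simp only [Pi.add_apply, Pi.single_eq_same] at h₂
  push_cast at h₁ h₂
  linarith [h₁.1, h₂.2]

/-- The site of the unit cube `(c, 1)` has depth `1`. [folklore] -/
theorem depth_one_self (c : Fin 4 → ℤ) : depth c 1 c = 1 := by
  unfold depth
  have h : (fun j : Fin 4 => min (c j - c j + 1).toNat (c j + ((1 : ℕ) : ℤ) - c j).toNat) = fun _ => 1 := by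
    funext j
    have e1 : c j - c j + 1 = 1 := by ring
    have e2 : c j + ((1 : ℕ) : ℤ) - c j = 1 := by push_cast; ring
    rw [e1, e2]
    rfl
  rw [h]
  exact Finset.inf'_const _ _

/-- For the unit cube the kernel `kerE` is evaluation at the exterior (no link is integrated). -/
theorem kerE_one_eq_self (r : LatticeRep G) (β : ℝ) (c : Fin 4 → ℤ) {A : LGConfig 4 G → ℝ} (hAm : Measurable A)
    {S : Finset (Literature.MathematicalPhysics.QuantumLattice.ZdEdge 4)} (hAS : IsCylinder A S) (η : LGConfig 4 G) :
    kerE G r β c 1 η A = A η :=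
  integral_ymSpecification_eq_self_of_forall_not_mem r β _ hAm hAS (fun e _ => not_mem_cubeEdges_one c e) η

end UnitCube

/-! ## §2 What `BoundaryDecayInUnitsPos` says at `(b, d) = (1, 1)` -/

section Corner

variable {G : Type} [Group G] [TopologicalSpace G] [IsTopologicalGroup G] [CompactSpace G]
  [MeasurableSpace G] [BorelSpace G]

/-- **The `(b, d) = (1, 1)` instance of `BoundaryDecayInUnitsPos G r a`.**  Reading the exterior link `((0 : ℤ⁴), 0)` of the unit cube at the origin
through a bounded continuous `f : G → ℝ` (`|f| ≤ M`) under two constant exteriors `g₁, g₂`: for `β ≥ β₆`,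
`|f g₁ − f g₂| ≤ K₆ · M · exp (−c₆ · a(β))`. -/
theorem abs_sub_le_of_boundaryDecayInUnitsPos (r : LatticeRep G) (a : ℝ → ℝ) (h : BoundaryDecayInUnitsPos G r a) :
    ∃ (c₆ β₆ K₆ : ℝ), 0 < c₆ ∧ ∀ β : ℝ, β₆ ≤ β → ∀ (f : G → ℝ) (M : ℝ), Continuous f → (∀ g, |f g| ≤ M) →
      ∀ g₁ g₂ : G, |f g₁ - f g₂| ≤ K₆ * M * Real.exp (-(c₆ * a β)) := by
  haveI := r.secondCountableTopology
  obtain ⟨c₆, β₆, K₆, hc₆, hdec⟩ := h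
  refine ⟨c₆, β₆, K₆, hc₆, fun β hβ f M hf hM g₁ g₂ => ?_⟩
  let e₀ : Literature.MathematicalPhysics.QuantumLattice.ZdEdge 4 := ((0 : Fin 4 → ℤ), (0 : Fin 4))
  let A : LGConfig 4 G → ℝ := fun U => f (U e₀)
  have hA : Continuous A := hf.comp (continuous_apply e₀)
  have hAS : IsCylinder A ({e₀} : Finset _) := by
    intro U V hUV
    exact congrArg f (hUV e₀ (by simp))
  have hdepth : ∀ e ∈ ({e₀} : Finset (Literature.MathematicalPhysics.QuantumLattice.ZdEdge 4)), 1 ≤ depth 0 1 e.1 := by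
    intro e he
    rw [Finset.mem_singleton] at he
    subst he
    exact (depth_one_self 0).ge
  have hb := hdec β hβ 0 1 1 (fun _ => g₁) (fun _ => g₂) A M {e₀} le_rfl hA (fun U => hM (U e₀)) hAS hdepth
  rw [kerE_one_eq_self r β 0 hA.measurable hAS, kerE_one_eq_self r β 0 hA.measurable hAS] at hb
  simpa [A] using hb

omit [IsTopologicalGroup G] [CompactSpace G] [MeasurableSpace G] [BorelSpace G] in
/-- A faithful unitary representation separates `1` from any `g ≠ 1` by a continuous function bounded by `2`:
`f = ‖ρ(·)ᵢⱼ − δᵢⱼ‖` at an entry where `ρ g ≠ 1`. [folklore] -/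
theorem exists_continuous_separating (r : LatticeRep G) {g : G} (hg : g ≠ 1) :
    ∃ f : G → ℝ, Continuous f ∧ (∀ x, |f x| ≤ 2) ∧ f 1 = 0 ∧ 0 < f g := by
  have hne : r.ρ g ≠ 1 := fun h => hg (r.injective (by rw [h, map_one]))
  obtain ⟨i, j, hij⟩ : ∃ i j, r.ρ g i j ≠ (1 : Matrix (Fin r.N) (Fin r.N) ℂ) i j := by
    by_contra h
    push Not at h
    exact hne (Matrix.ext fun i j => h i j)
  refine ⟨fun x => ‖r.ρ x i j - (1 : Matrix (Fin r.N) (Fin r.N) ℂ) i j‖, ?_, ?_, ?_, ?_⟩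
  · exact ((r.continuous.matrix_elem i j).sub continuous_const).norm
  · intro x
    rw [abs_of_nonneg (norm_nonneg _)]
    refine (norm_sub_le _ _).trans ?_
    have h1 := entry_norm_bound_of_unitary (r.mem_unitary x) i j
    have h2 := entry_norm_bound_of_unitary (Submonoid.one_mem (Matrix.unitaryGroup (Fin r.N) ℂ)) i j
    linarith
  · simp
  · exact norm_pos_iff.2 (sub_ne_zero.2 hij)

/-- **`BoundaryDecayInUnitsPos` forces the unit map to be bounded above on a tail** (non-trivial gauge group): from the `(1, 1)` corner with a
separating function, `e^{c₆ a(β)} ≤ 2 K₆ / δ` for `β ≥ β₆`. -/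
theorem exists_forall_le_of_boundaryDecayInUnitsPos (r : LatticeRep G) (a : ℝ → ℝ) (hG : ∃ g : G, g ≠ 1)
    (h : BoundaryDecayInUnitsPos G r a) : ∃ β₆ B : ℝ, ∀ β : ℝ, β₆ ≤ β → a β ≤ B := by
  obtain ⟨g, hg⟩ := hG
  obtain ⟨f, hf, hf2, hf1, hfg⟩ := exists_continuous_separating r hg
  obtain ⟨c₆, β₆, K₆, hc₆, hdec⟩ := abs_sub_le_of_boundaryDecayInUnitsPos r a h
  refine ⟨β₆, Real.log (2 * K₆ / f g) / c₆, fun β hβ => ?_⟩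
  have hb := hdec β hβ f 2 hf hf2 g 1
  rw [hf1, sub_zero, abs_of_pos hfg] at hb
  -- `f g ≤ K₆ · 2 · e^{−c₆ a β}`, so `e^{c₆ a β} ≤ 2 K₆ / f g`
  have hexp : Real.exp (c₆ * a β) ≤ 2 * K₆ / f g := by
    rw [le_div_iff₀ hfg]
    have := mul_le_mul_of_nonneg_left hb (Real.exp_pos (c₆ * a β)).le
    calc Real.exp (c₆ * a β) * f g ≤ Real.exp (c₆ * a β) * (K₆ * 2 * Real.exp (-(c₆ * a β))) := this
      _ = 2 * K₆ := by rw [Real.exp_neg]; field_simp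
  have hpos : 0 < 2 * K₆ / f g := lt_of_lt_of_le (Real.exp_pos _) hexp
  rw [le_div_iff₀ hc₆, mul_comm]
  exact (Real.le_log_iff_exp_le hpos).2 hexp

/-- **Hence `BoundaryDecayInUnitsPos G r a` fails for every `a` unbounded above on every tail** (non-trivial gauge group) — e.g. `a = id`. -/
theorem not_boundaryDecayInUnitsPos_of_unbounded (r : LatticeRep G) (a : ℝ → ℝ) (hG : ∃ g : G, g ≠ 1)
    (ha : ∀ β₀ B : ℝ, ∃ β : ℝ, β₀ ≤ β ∧ B < a β) : ¬ BoundaryDecayInUnitsPos G r a := fun h => by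
  obtain ⟨β₆, B, hB⟩ := exists_forall_le_of_boundaryDecayInUnitsPos r a hG h
  obtain ⟨β, hβ, hlt⟩ := ha β₆ B
  exact absurd (hB β hβ) (not_le.2 hlt)

omit [TopologicalSpace G] [IsTopologicalGroup G] [CompactSpace G] [MeasurableSpace G] [BorelSpace G] in
/-- A simple compact group (non-abelian by definition) has an element `≠ 1`. [folklore] -/
theorem exists_ne_one_of_isSimpleCompactGroup [TopologicalSpace G] (hG : IsSimpleCompactGroup G) : ∃ g : G, g ≠ 1 := by
  obtain ⟨x, y, hxy⟩ := hG.2.1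
  exact ⟨x, fun hx => hxy (by rw [hx, one_mul, mul_one])⟩

end Corner

/-! ## §3 `BoundaryDecayAllPos` is unsatisfiable -/

/-- **`¬ BoundaryDecayAllPos`** (ClassDefs §6, p486516): at `G = SU(2)`, any lattice representation `r` and the «unit map» `a = id` (admitted,
since the text quantifies over EVERY `a : ℝ → ℝ`), the `(b, d) = (1, 1)` corner demands `δ ≤ 2 K₆ e^{−c₆ β}` for all `β ≥ β₆` with a fixed
`δ > 0`.  So the closers taking `BoundaryDecayAllPos` (p486809) or its `∀ a` inline form (p486406) are vacuous; the guarded form of §5 is the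
intended input. -/
theorem not_boundaryDecayAllPos : ¬ BoundaryDecayAllPos := by
  intro h
  have hG : IsCompactSimpleLieGroup (Matrix.specialUnitaryGroup (Fin 2) ℂ) :=
    isCompactSimpleLieGroup_specialUnitaryGroup isSimpleCompactGroup_specialUnitaryGroup_holds le_rfl
  letI : MeasurableSpace (Matrix.specialUnitaryGroup (Fin 2) ℂ) := borel _
  haveI : BorelSpace (Matrix.specialUnitaryGroup (Fin 2) ℂ) := ⟨rfl⟩
  obtain ⟨r⟩ := hG.2
  refine not_boundaryDecayInUnitsPos_of_unbounded r (fun β => β) (exists_ne_one_of_isSimpleCompactGroup hG.1)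
    (fun β₀ B => ⟨max β₀ (B + 1), le_max_left _ _, ?_⟩) (h _ hG r fun β => β)
  exact lt_of_lt_of_le (lt_add_one B) (le_max_right _ _)

/-- `BoundaryDecayAllPos ↔ False`. -/
theorem boundaryDecayAllPos_iff_false : BoundaryDecayAllPos ↔ False :=
  ⟨not_boundaryDecayAllPos, False.elim⟩

/-- The same unsatisfiability for the inline `∀ a` hypothesis of `ti_of_boundaryDecayPos` / `rotRev2'_of_nrot3_of_boundaryDecayPos` (p486406),
which is `BoundaryDecayAllPos` unfolded. -/
theorem not_forall_boundaryDecayInUnitsPos :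
    ¬ (∀ (G : Type) [Group G] [TopologicalSpace G] [IsTopologicalGroup G] [CompactSpace G],
      IsCompactSimpleLieGroup G → letI : MeasurableSpace G := borel G; haveI : BorelSpace G := ⟨rfl⟩;
      ∀ (r : LatticeRep G) (a : ℝ → ℝ), BoundaryDecayInUnitsPos G r a) :=
  not_boundaryDecayAllPos

/-! ## §4 For the intended unit maps the corner is harmless -/

section Harmless

variable {G : Type} [Group G] [TopologicalSpace G] [IsTopologicalGroup G] [CompactSpace G]
  [MeasurableSpace G] [BorelSpace G]

omit [Group G] [TopologicalSpace G] [IsTopologicalGroup G] [CompactSpace G] [MeasurableSpace G] [BorelSpace G] in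
/-- **The `(b, d) = (1, 1)` corner under the guard `a → 0`**: for a unit map tending to `0` there is a tail on which `a ≤ 1`, and then the corner
inequality `|f g₁ − f g₂| ≤ K₆ · M · exp (−c₆ · a(β))` holds for EVERY bounded `f` with `K₆ = 2 e^{c₆}` — the corner carries no information (g4's
«trivial regime»), so the guarded input of §5 is not refutable this way. [folklore] -/
theorem corner_of_tendsto_zero (a : ℝ → ℝ) (ha0 : Tendsto a atTop (𝓝 0)) {c₆ : ℝ} (hc₆ : 0 < c₆) :
    ∃ β₆ : ℝ, ∀ β : ℝ, β₆ ≤ β → ∀ (f : G → ℝ) (M : ℝ), (∀ g, |f g| ≤ M) →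
      ∀ g₁ g₂ : G, |f g₁ - f g₂| ≤ 2 * Real.exp c₆ * M * Real.exp (-(c₆ * a β)) := by
  obtain ⟨β₆, hβ₆⟩ := (ha0.eventually (eventually_le_nhds one_pos)).exists_forall_of_atTop
  refine ⟨β₆, fun β hβ f M hM g₁ g₂ => ?_⟩
  have hM0 : 0 ≤ M := (abs_nonneg _).trans (hM g₁)
  have h1 : |f g₁ - f g₂| ≤ 2 * M := by
    have := abs_sub (f g₁) (f g₂)
    linarith [hM g₁, hM g₂]
  have h2 : (1 : ℝ) ≤ Real.exp c₆ * Real.exp (-(c₆ * a β)) := by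
    rw [← Real.exp_add]
    exact Real.one_le_exp (by nlinarith [hβ₆ β hβ])
  calc |f g₁ - f g₂| ≤ 2 * M := h1
    _ = 2 * M * 1 := (mul_one _).symm
    _ ≤ 2 * M * (Real.exp c₆ * Real.exp (-(c₆ * a β))) := mul_le_mul_of_nonneg_left h2 (by positivity)
    _ = 2 * Real.exp c₆ * M * Real.exp (-(c₆ * a β)) := by ring

end Harmless

/-! ## §5 The guarded form of the input and its closers -/

/-- **`TI ⇐ boundary-influence decay BEHIND THE GUARDS of `TI`**: if for every compact simple `G`, every `r` and every positive unit map `a → 0`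
carrying `MomentBounds6 G r a` and `GapInUnits G r a` the cube kernels satisfy `BoundaryDecayInUnitsPos G r a`, then the tilt bracket vanishes on
the tilt cells of any Pythagorean triple on its fitted class.  (The hypothesis is `BoundaryDecayAllPos` restricted to the guard block of
`TI` / `NROT3` / `KingOnClass`, verbatim; the proof uses it only at the `(G, r, a)` at which `TI` is asked.) -/
theorem ti_of_boundaryDecayGuarded (t : PythTriple)
    (hBD : ∀ (G : Type) [Group G] [TopologicalSpace G] [IsTopologicalGroup G] [CompactSpace G],
      IsCompactSimpleLieGroup G → letI : MeasurableSpace G := borel G; haveI : BorelSpace G := ⟨rfl⟩;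
      ∀ (r : LatticeRep G) (a : ℝ → ℝ), (∀ β, 0 < a β) → Tendsto a atTop (𝓝 0) → MomentBounds6 G r a →
        GapInUnits G r a → BoundaryDecayInUnitsPos G r a) :
    TI t.tiltCell (fittedClass t.q) := by
  intro G _ _ _ _ hG
  letI : MeasurableSpace G := borel G
  haveI : BorelSpace G := ⟨rfl⟩
  intro r a ha ha0 hUV hIR
  exact tiltInsensitivityOn_of_boundaryDecayInUnitsPos t r a (hBD G hG r a ha ha0 hUV hIR)

/-- **`KingOnClass ⇐ N-ROT.3 (King's data) ∧ guarded boundary-influence decay.** -/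
theorem kingOnClass_of_nrot3_of_boundaryDecayGuarded (h3 : NROT3 king345.tiltCell (Real.arcsin (3 / 5)) (fittedClass 5))
    (hBD : ∀ (G : Type) [Group G] [TopologicalSpace G] [IsTopologicalGroup G] [CompactSpace G],
      IsCompactSimpleLieGroup G → letI : MeasurableSpace G := borel G; haveI : BorelSpace G := ⟨rfl⟩;
      ∀ (r : LatticeRep G) (a : ℝ → ℝ), (∀ β, 0 < a β) → Tendsto a atTop (𝓝 0) → MomentBounds6 G r a →
        GapInUnits G r a → BoundaryDecayInUnitsPos G r a) :
    KingOnClass :=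
  kingOnClass_of_tilt345 h3 (ti_of_boundaryDecayGuarded king345 hBD)

/-- **`ROT` rev 2′ (text of record for R85) ⇐ N-ROT.3 (King's data) ∧ guarded boundary-influence decay** — the typed census of the crux after the
second erratum: the two-regularisation comparison on King's class (leg 1, XL, unprinted) and exponential weak mixing of the cube kernels in units
`a` at the unit maps of the legs (mass-gap strength, open at weak coupling). -/
theorem rotRev2'_of_nrot3_of_boundaryDecayGuarded (h3 : NROT3 king345.tiltCell (Real.arcsin (3 / 5)) (fittedClass 5))
    (hBD : ∀ (G : Type) [Group G] [TopologicalSpace G] [IsTopologicalGroup G] [CompactSpace G],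
      IsCompactSimpleLieGroup G → letI : MeasurableSpace G := borel G; haveI : BorelSpace G := ⟨rfl⟩;
      ∀ (r : LatticeRep G) (a : ℝ → ℝ), (∀ β, 0 < a β) → Tendsto a atTop (𝓝 0) → MomentBounds6 G r a →
        GapInUnits G r a → BoundaryDecayInUnitsPos G r a) :
    ROTRev2' :=
  rotRev2'_of_tilt345 h3 (ti_of_boundaryDecayGuarded king345 hBD)

end Summit.QuantumFields.YangMills.Theorems.ROT

end
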